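import Mathlib

/-!
# `𝔸⁴/(J₂ ⊕ J₂)`: the centre is stable and the chart augmentation ideal is `(x₀)` (programme T, stubs S2a, S4alg)

(crux stmt-ResolutionOfSingularities-15640 `WildQuotients.WildQuotientResolution`, line `Sketch`,
programme «INSTANTIATE T1» = `𝔸⁴/(J₂ ⊕ J₂)` of chain w45c; candidate stubs S2a
`stub_twoBlocks_map_centre` and S4alg `stub_twoBlocks_chart_augIdeal` of
`L/w45c/W45cPlanSignaturesV2.lean` (plan-1), signatures verbatim; [OURS · L1 W4.5c] — NOT a
statement of any manuscript.)

* `stub_twoBlocks_map_centre` — for `σ` with `σ x₀ = x₀`, `σ x₂ = x₂` the centre `(x₀, x₂)` of the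
  blow-up is `σ`-stable: `σ (x₀, x₂) = (x₀, x₂)` (generatorwise).
* `sub_mem_span_X_zero_of_chart`, `stub_twoBlocks_chart_augIdeal` — on the `x₀`-chart of
  `Bl_{(x₀,x₂)} 𝔸⁴` (coordinates `x₀, x₁, a = x₂/x₀, x₃`, the letter `X 2` standing for `a`) the
  lifted automorphism `τ : x₁ ↦ x₁ + x₀, x₃ ↦ x₃ + x₀ a` (others fixed) satisfies `τ f ≡ f mod x₀`
  for every `f` (induction on `f`: `τ (f g) - f g = (τ f - f) τ g + f (τ g - g)`), and
  `x₀ = τ x₁ - x₁`; so the augmentation ideal `(τ f - f : f)` is the principal ideal `(x₀)` — the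
  Király–Lütkebohmert terminal state on this chart.
-/

-- single-problem summit: the doubled namespace component `ResolutionOfSingularities` is forced
set_option linter.dupNamespace false

noncomputable section

open MvPolynomial

namespace Summit.ResolutionOfSingularities.ResolutionOfSingularities.Theorems.WildQuotientResolution.TwoBlocks

/-- STUB S2a `stub_twoBlocks_map_centre` (S, classical): the centre `(x₀, x₂)` is `σ`-stable
(indeed fixed generatorwise), the hypothesis `hρ` of `IsBlowup.liftAction` once transported to the
ideal sheaf of `Spec k[x]`. [folklore] -/
theorem stub_twoBlocks_map_centre (k : Type) [Field k]
    (σ : MvPolynomial (Fin 4) k ≃ₐ[k] MvPolynomial (Fin 4) k)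
    (h0 : σ (X 0) = X 0) (h2 : σ (X 2) = X 2) :
    Ideal.map (σ : MvPolynomial (Fin 4) k →+* MvPolynomial (Fin 4) k) (Ideal.span {X 0, X 2}) =
      Ideal.span {X 0, X 2} := by
  rw [Ideal.map_span, Set.image_pair]
  change Ideal.span {σ (X 0), σ (X 2)} = _
  rw [h0, h2]

/-- **`τ f ≡ f (mod x₀)` on the `x₀`-chart.** For a `k`-algebra endomorphism-like automorphism `τ`
of `k[x₀,…,x₃]` with `τ x₀ = x₀`, `τ x₁ = x₁ + x₀`, `τ x₂ = x₂`, `τ x₃ = x₃ + x₀ x₂`, every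
`τ f - f` is divisible by `x₀`: true on the generators and preserved under sums and products
(`τ (f g) - f g = (τ f - f) τ g + f (τ g - g)`). [folklore] -/
theorem sub_mem_span_X_zero_of_chart (k : Type) [Field k]
    (τ : MvPolynomial (Fin 4) k ≃ₐ[k] MvPolynomial (Fin 4) k)
    (h0 : τ (X 0) = X 0) (h1 : τ (X 1) = X 1 + X 0)
    (h2 : τ (X 2) = X 2) (h3 : τ (X 3) = X 3 + X 0 * X 2) (f : MvPolynomial (Fin 4) k) :
    τ f - f ∈ Ideal.span ({X 0} : Set (MvPolynomial (Fin 4) k)) := by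
  have hX : ∀ i : Fin 4, τ (X i) - X i ∈ Ideal.span ({X 0} : Set (MvPolynomial (Fin 4) k)) := by
    intro i
    match i with
    | 0 => rw [h0, sub_self]; exact Ideal.zero_mem _
    | 1 => rw [h1, add_sub_cancel_left]; exact Ideal.subset_span rfl
    | 2 => rw [h2, sub_self]; exact Ideal.zero_mem _
    | 3 =>
      rw [h3, add_sub_cancel_left]
      exact Ideal.mul_mem_right _ _ (Ideal.subset_span rfl)
  induction f using MvPolynomial.induction_on with
  | C c =>
    have hc : τ (C c) = C c := τ.commutes c
    rw [hc, sub_self]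
    exact Ideal.zero_mem _
  | add f g hf hg =>
    have : τ (f + g) - (f + g) = (τ f - f) + (τ g - g) := by rw [map_add]; ring
    rw [this]
    exact Ideal.add_mem _ hf hg
  | mul_X f i hf =>
    have : τ (f * X i) - f * X i = (τ f - f) * τ (X i) + f * (τ (X i) - X i) := by
      rw [map_mul]; ring
    rw [this]
    exact Ideal.add_mem _ (Ideal.mul_mem_right _ _ hf) (Ideal.mul_mem_left _ _ (hX i))

/-- STUB S4alg `stub_twoBlocks_chart_augIdeal` (S–M, classical; the chart law behind `hdiv`): on
the `x₀`-chart of the blow-up (coordinates `x₀, x₁, a, x₃` with `x₂ = x₀ a`, here `a` is written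
`X 2`) the induced automorphism `τ : x₁ ↦ x₁ + x₀, x₃ ↦ x₃ + x₀·a` (others fixed) has augmentation
ideal `⟨τ f − f⟩ = (x₀)`: every `τ f − f` is divisible by `x₀` (`τ ≡ id mod x₀`,
`sub_mem_span_X_zero_of_chart`) and `x₀ = τ x₁ − x₁`. The `x₂`-chart is the same statement with
the roles of the two blocks exchanged. [folklore] -/
theorem stub_twoBlocks_chart_augIdeal (k : Type) [Field k]
    (τ : MvPolynomial (Fin 4) k ≃ₐ[k] MvPolynomial (Fin 4) k)
    (h0 : τ (X 0) = X 0) (h1 : τ (X 1) = X 1 + X 0)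
    (h2 : τ (X 2) = X 2) (h3 : τ (X 3) = X 3 + X 0 * X 2) :
    Ideal.span (Set.range fun f : MvPolynomial (Fin 4) k => τ f - f) = Ideal.span {X 0} := by
  apply le_antisymm
  · refine Ideal.span_le.mpr ?_
    rintro _ ⟨f, rfl⟩
    exact sub_mem_span_X_zero_of_chart k τ h0 h1 h2 h3 f
  · refine Ideal.span_le.mpr ?_
    rintro _ rfl
    refine Ideal.subset_span ⟨X 1, ?_⟩
    change τ (X 1) - X 1 = X 0
    rw [h1, add_sub_cancel_left]

end Summit.ResolutionOfSingularities.ResolutionOfSingularities.Theorems.WildQuotientResolution.TwoBlocks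

end
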